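import Summits.HodgeConjecture.HodgeConjecture.Theorems.F0P3cStCharTSWeylHypJacobianLocal   -- ★ p851645 (LH6-p03 g5) «(B-jac) LOCAL»: the local socket `hJacLoc`; brings ★ p849811 (B-jac) and ★ p849733 radial kit (fibre count, Weil factorisation, (B1) `fibre_dichotomy`)
import HarnessLib

/-!
# F0 · P3c · line LH6 «StCharTS» — ROAD «JAC-LOC» brick (J1), FILE 1 «TUBE-σ»: the radial measure `σ` EVALUATES EVERY TUBE `Φ(A × V)` over a `W`-free regular `V`
# (and every regular point of the split torus has a `W`-free regular neighbourhood)
# (Harish-Chandra 1970 Lemma 22 ∕ 42; Rogawski 1990 §12.5 p. 182; Weil 1965 n° 49)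

Cell `pub/hodgecm-mathlib`, crux H413 = `stmt-HodgeConjecture-24833` (lane `--supports`, helper); seat LH6-p04 (g6); brick (J1) of LH6-p03 (g5)'s ROAD «JAC-LOC»
(dealt 2026-09-02T14:11:30Z; road target: discharge `hJacLoc` of ★ p851645 for `D = |det(1 − Ad t)|_{𝔤∕𝔱}` by level-subgroup bookkeeping, bricks (J2)–(J6)).  THEOREMS
ONLY; sorry-free; no definition ∕ instance ∕ notation; axioms TRIO.  HONEST LABEL: count-neutral, closes no organ; HC_CM is proved only modulo the 7 printed
citations (2 remaining: hLiu418 = `stmt-HodgeConjecture-24832`, h413 = `stmt-HodgeConjecture-24833`) until rung 0 closes.  (The road pays the HYPERBOLIC half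
of the print residue «WIF» of the (S-𝔇) organ `stub_EllipticPackage` of `Cruxes/H413/Lines/F0_P3c_StCharTSPaydown.lean`.)

WHAT (chart-free measure theory; binders = ★ p851645 `lintegral_hypSet_eq_of_tubeJacobian_local` up to `hw` ∕ `hD` VERBATIM; `G = U(Φ₃)(L⁺_v)`, `T` the split
torus `(cmBorelTriple L 3 v).M`, `μ₀` the quotient measure on `G ⧸ T`, `Φ(q, t) = x t x⁻¹`, `Ω` the hyperbolic set, `w` the Weyl element):
* §1 **`exists_radialMeasure_tube`** — there is a measure `σ` on `T`, finite on compacts, σ-finite, carried by `T^{reg}`, which is THE radial measure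
  (`2 · ∫⁻_Ω f dν = ∫⁻_T ∫⁻_{G⧸T} f(Φ(q,t)) dμ₀ dσ` for every Borel `f ≥ 0`) AND EVALUATES EVERY TUBE: for every measurable `A ⊆ G ⧸ T` and every measurable
  regular `W`-free `V ⊆ T`, **`ν(Φ(A × V)) = μ₀(A) · σ(V)`**.  (= §a–§d of ★ p849811's proof extracted: the fibre-count pull-back `μ` of `ν` (★
  `exists_measure_apply_eq_lintegral_count_fibre`), its Weil factorisation `μ = μ₀ ⊗ σ` (★ `exists_radial_prod_eq_fibreCount_conjFamily`), and «every fibre of `Φ` meets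
  `A × V` at most once» (★ (B1) `fibre_dichotomy`) — valid for ANY `A`, which is what makes the Jacobian a LOCAL question.)
* §2 **`exists_isOpen_regular_wfree_nhds`** — every regular `t₀` has an open neighbourhood of regular elements on which `t′ ≠ w t w⁻¹` (★ p849811 §e, exported).
The COSET REDUCTION proper — `hJacLoc` of ★ p851645 from the tube identity on open sets ∕ on a disjoint covering family ∕ on a π-system containing `U` — is the sequel
`Theorems/F0P3cStCharTSWeylHypTubeReduction.lean` (400-line rule).

## References
* [HarishChandra1970] Harish-Chandra, *Harmonic analysis on reductive p-adic groups*, LNM 162 (1970), Lemma 22 (Jacobian of conjugation), Lemma 42 (Weyl integration).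
* [Rogawski1990] J. D. Rogawski, *Automorphic Representations of Unitary Groups in Three Variables*, Ann. of Math. Stud. 123 (1990), §12.5 p. 182.
* [vanDijk1972] G. van Dijk, *Computation of certain induced characters of p-adic groups*, Math. Ann. 199 (1972) 229–240, §2.
* [Weil1965] A. Weil, *Sur la formule de Siegel dans la théorie des groupes classiques*, Acta Math. 113 (1965), n° 49 Lemme 22 (p. 70).
-/

set_option autoImplicit false
set_option linter.dupNamespace false

noncomputable section

open MeasureTheory Measure Set Filter Topology Function NumberField IsDedekindDomain Matrix Polynomial
open Literature.MeasureTheory.Group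
open Literature.NumberTheory.Automorphic Literature.NumberTheory.Automorphic.UnitaryGroup Literature.NumberTheory.Rogawski1990
open Summit.HodgeConjecture.HodgeConjecture.Cruxes.H413.F0P3cStCharTSWeylHypFibre
open Summit.HodgeConjecture.HodgeConjecture.Cruxes.H413.F0P3cStCharTSWeylHypNormaliser
open Summit.HodgeConjecture.HodgeConjecture.Cruxes.H413.F0P3cStCharTSWeylHypTorsor
open Summit.HodgeConjecture.HodgeConjecture.Cruxes.H413.F0P3cStCharTSWeylHypCM
open Summit.HodgeConjecture.HodgeConjecture.Cruxes.H413.F0P3cStCharTSWeylHypMeasure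
open Summit.HodgeConjecture.HodgeConjecture.Cruxes.H413.F0P3cStCharTSWeylHypJacobian
open scoped ENNReal NNReal MatrixGroups Pointwise

namespace Summit.HodgeConjecture.HodgeConjecture.Cruxes.H413.F0P3cStCharTSWeylHypTubeSigma

/-! ## §0 Generic measure theory -/

/-- **Two measures that agree on the traces `O ∩ S` of the open sets on a set `S` of finite `μ`-measure agree on `S`** (Borel space; open sets form a π-system generating
the Borel σ-algebra; `ext_of_generate_finite` for the finite measures `μ|_S`, `ρ|_S`). [cite: Weil1965, n° 49 Lemme 22 (p. 70)] -/
theorem restrict_eq_restrict_of_forall_isOpen {α : Type*} [TopologicalSpace α] [MeasurableSpace α] [BorelSpace α] {μ ρ : Measure α} {S : Set α}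
    (hfin : μ S ≠ ∞) (h : ∀ O : Set α, IsOpen O → μ (O ∩ S) = ρ (O ∩ S)) :
    μ.restrict S = ρ.restrict S := by
  haveI : IsFiniteMeasure (μ.restrict S) := ⟨by rw [Measure.restrict_apply_univ]; exact hfin.lt_top⟩
  refine ext_of_generate_finite {O : Set α | IsOpen O} BorelSpace.measurable_eq isPiSystem_isOpen ?_ ?_
  · intro O hO
    rw [Measure.restrict_apply hO.measurableSet, Measure.restrict_apply hO.measurableSet]
    exact h O hO
  · rw [Measure.restrict_apply_univ, Measure.restrict_apply_univ]
    simpa only [Set.univ_inter] using h Set.univ isOpen_univ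

/-- **σ-additivity on a countable disjoint cover**: if `𝒟` is a countable family of pairwise disjoint measurable sets with union `O`, then
`μ O = ∑' C : 𝒟, μ C`. [folklore] -/
theorem measure_eq_tsum_of_sUnion_eq {α : Type*} [MeasurableSpace α] (μ : Measure α) {𝒟 : Set (Set α)} {O : Set α}
    (hc : 𝒟.Countable) (hd : 𝒟.Pairwise Disjoint) (hm : ∀ C ∈ 𝒟, MeasurableSet C) (hU : ⋃₀ 𝒟 = O) :
    μ O = ∑' C : 𝒟, μ C := by
  rw [← hU, measure_sUnion hc hd hm]

section CM

variable (L : Type) [Field L] [NumberField L] [IsCMField L] (v : HeightOneSpectrum (𝓞 ↥(maximalRealSubfield L)))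

/-! ## §1 The radial measure `σ` evaluates every tube `Φ(A × V)` over a `W`-free regular `V` -/

set_option maxHeartbeats 3200000 in
set_option synthInstance.maxHeartbeats 200000 in
-- the §a–§d extraction of ★ p849811 (same elaboration class: instance terms on the CM local carrier and its quotient)
/-- **(J1)(a) «TUBE-σ»**: on `G = U(Φ₃)(L⁺_v)` (`v` non-split) with the split torus `T`, a Haar measure `ν`, a Haar-type `tm` on `T` and the quotient measure
`μ₀` on `G ⧸ T`, there is a measure `σ` on `T` — finite on compacts, σ-finite, carried by `T^{reg}` — such that (i) `σ` IS the radial measure of ★ p849733: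
`2 · ∫⁻_Ω f dν = ∫⁻_T ∫⁻_{G ⧸ T} f(Φ(q, t)) dμ₀(q) dσ(t)` for every Borel `f ≥ 0`; (ii) for EVERY measurable `A ⊆ G ⧸ T` and every measurable `W`-free regular `V ⊆ T`,
**`ν(Φ(A × V)) = μ₀(A) · σ(V)`**.  Proof = §a–§d of ★ p849811 `lintegral_hypSet_eq_of_tubeJacobian` (fibre-count pull-back, Weil factorisation `μ = μ₀ ⊗ σ`, and
«every fibre of `Φ` meets `A × V` exactly once over its image» by ★ (B1) `fibre_dichotomy`). [cite: HarishChandra1970, Lemma 22; Lemma 42] [cite: Weil1965, n° 49 Lemme 22 (p. 70)]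
[cite: Rogawski1990, §12.5 p. 182] -/
theorem exists_radialMeasure_tube
    (hns : ∀ w : PlacesOver L v, IsCMField.complexConj L • w.1 = w.1)
    [MeasurableSpace ↥(unitaryGroupOfForm (conjLocal L (IsCMField.complexConj L) v) (cmLocalForm L 3 v))] [BorelSpace ↥(unitaryGroupOfForm (conjLocal L (IsCMField.complexConj L) v) (cmLocalForm L 3 v))] [LocallyCompactSpace ↥(unitaryGroupOfForm (conjLocal L (IsCMField.complexConj L) v) (cmLocalForm L 3 v))] [SecondCountableTopology ↥(unitaryGroupOfForm (conjLocal L (IsCMField.complexConj L) v) (cmLocalForm L 3 v))] [T2Space ↥(unitaryGroupOfForm (conjLocal L (IsCMField.complexConj L) v) (cmLocalForm L 3 v))]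
    [MeasurableSpace (↥(unitaryGroupOfForm (conjLocal L (IsCMField.complexConj L) v) (cmLocalForm L 3 v)) ⧸ (cmBorelTriple L 3 v).M)] [BorelSpace (↥(unitaryGroupOfForm (conjLocal L (IsCMField.complexConj L) v) (cmLocalForm L 3 v)) ⧸ (cmBorelTriple L 3 v).M)]
    (ν : Measure ↥(unitaryGroupOfForm (conjLocal L (IsCMField.complexConj L) v) (cmLocalForm L 3 v))) [ν.IsHaarMeasure] [ν.IsMulRightInvariant]
    (tm : Measure ↥(cmBorelTriple L 3 v).M) [tm.IsMulLeftInvariant] [IsFiniteMeasureOnCompacts tm] [tm.IsOpenPosMeasure] [tm.IsInvInvariant]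
    (Φ : (↥(unitaryGroupOfForm (conjLocal L (IsCMField.complexConj L) v) (cmLocalForm L 3 v)) ⧸ (cmBorelTriple L 3 v).M) × ↥(cmBorelTriple L 3 v).M → ↥(unitaryGroupOfForm (conjLocal L (IsCMField.complexConj L) v) (cmLocalForm L 3 v))) (hΦ : ∀ (x : ↥(unitaryGroupOfForm (conjLocal L (IsCMField.complexConj L) v) (cmLocalForm L 3 v))) (t : ↥(cmBorelTriple L 3 v).M), Φ (QuotientGroup.mk x, t) = x * t * x⁻¹)
    (w : ↥(unitaryGroupOfForm (conjLocal L (IsCMField.complexConj L) v) (cmLocalForm L 3 v))) (hw : Units.val (w : GL (Fin 3) (LocalRing L v)) = cmLocalForm L 3 v) :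
    ∃ σ : Measure ↥(cmBorelTriple L 3 v).M, IsFiniteMeasureOnCompacts σ ∧ SigmaFinite σ ∧
      σ {t : ↥(cmBorelTriple L 3 v).M | ¬ IsRegularElt (((t : ↥(unitaryGroupOfForm (conjLocal L (IsCMField.complexConj L) v) (cmLocalForm L 3 v)))) : GL (Fin 3) (LocalRing L v))} = 0 ∧
      (∀ f : ↥(unitaryGroupOfForm (conjLocal L (IsCMField.complexConj L) v) (cmLocalForm L 3 v)) → ℝ≥0∞, Measurable f →
        2 * ∫⁻ y in {x | ∃ g t : ↥(unitaryGroupOfForm (conjLocal L (IsCMField.complexConj L) v) (cmLocalForm L 3 v)), t ∈ (cmBorelTriple L 3 v).M ∧ IsRegularElt (t : GL (Fin 3) (LocalRing L v)) ∧ g * t * g⁻¹ = x}, f y ∂ν = ∫⁻ t, ∫⁻ q, f (Φ (q, t)) ∂(quotientMeasure (cmBorelTriple L 3 v).M tm (isClosed_cmBorelTriple_M L v) ν) ∂σ) ∧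
      ∀ A : Set (↥(unitaryGroupOfForm (conjLocal L (IsCMField.complexConj L) v) (cmLocalForm L 3 v)) ⧸ (cmBorelTriple L 3 v).M), MeasurableSet A → ∀ V : Set ↥(cmBorelTriple L 3 v).M, MeasurableSet V → (∀ t ∈ V, IsRegularElt (((t : ↥(unitaryGroupOfForm (conjLocal L (IsCMField.complexConj L) v) (cmLocalForm L 3 v)))) : GL (Fin 3) (LocalRing L v))) →
        (∀ t ∈ V, ∀ t' ∈ V, ((t' : ↥(cmBorelTriple L 3 v).M) : ↥(unitaryGroupOfForm (conjLocal L (IsCMField.complexConj L) v) (cmLocalForm L 3 v))) ≠ w * t * w⁻¹) →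
          ν (Φ '' (A ×ˢ V)) = (quotientMeasure (cmBorelTriple L 3 v).M tm (isClosed_cmBorelTriple_M L v) ν) A * σ V := by
  classical
  -- §a data of the carrier (★ (B0)): field-like ring, split form, regular element; `T` closed abelian, `|W| = 2`, centralisers
  haveI : Nontrivial (LocalRing L v) := UnitaryGroup.nontrivial_localRing L v
  have hR : ∀ x : LocalRing L v, x ≠ 0 → IsUnit x := isUnit_of_ne_zero_of_nonsplit L v hns
  have hJ : cmLocalForm L 3 v = (StdForm.antidiagonal 3).over (LocalRing L v) := cmLocalForm_eq_over L 3 v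
  have hex := exists_mem_torusU_isRegularElt L v
  have hT := isClosed_cmBorelTriple_M L v
  haveI := hT
  have hTc : ∀ a ∈ (cmBorelTriple L 3 v).M, ∀ b ∈ (cmBorelTriple L 3 v).M, a * b = b * a := fun a ha b hb => mul_comm_of_mem_torusU_cmLocal L v ha hb
  have hW : (((cmBorelTriple L 3 v).M).subgroupOf (Subgroup.normalizer (((cmBorelTriple L 3 v).M : Subgroup ↥(unitaryGroupOfForm (conjLocal L (IsCMField.complexConj L) v) (cmLocalForm L 3 v))) : Set ↥(unitaryGroupOfForm (conjLocal L (IsCMField.complexConj L) v) (cmLocalForm L 3 v))))).index = 2 :=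
    index_torusU_subgroupOf_normalizer_eq_two (conjLocal L (IsCMField.complexConj L) v) hR hJ hex
  have hW0 := ne_of_eq_of_ne hW two_ne_zero
  -- §b topology ∕ measurability: Polish product, `Φ` continuous, `T^{reg}` open, `Ω` and its regular part `D_Ω` Borel
  haveI : PolishSpace ((↥(unitaryGroupOfForm (conjLocal L (IsCMField.complexConj L) v) (cmLocalForm L 3 v)) ⧸ (cmBorelTriple L 3 v).M) × ↥(cmBorelTriple L 3 v).M) := polishSpace_quotient_prod_subgroup (cmBorelTriple L 3 v).M hT
  have hΦc : Continuous Φ := (continuous_conjFamily_and_smul (cmBorelTriple L 3 v).M Φ hΦ).1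
  haveI : SecondCountableTopology ↥(cmBorelTriple L 3 v).M := TopologicalSpace.Subtype.secondCountableTopology _
  haveI : BorelSpace ((↥(unitaryGroupOfForm (conjLocal L (IsCMField.complexConj L) v) (cmLocalForm L 3 v)) ⧸ (cmBorelTriple L 3 v).M) × ↥(cmBorelTriple L 3 v).M) := Prod.borelSpace
  haveI : T1Space (↥(unitaryGroupOfForm (conjLocal L (IsCMField.complexConj L) v) (cmLocalForm L 3 v)) ⧸ (cmBorelTriple L 3 v).M) := QuotientGroup.instT1Space
  haveI : MeasurableSingletonClass (↥(unitaryGroupOfForm (conjLocal L (IsCMField.complexConj L) v) (cmLocalForm L 3 v)) ⧸ (cmBorelTriple L 3 v).M) := ⟨fun x => isClosed_singleton.measurableSet⟩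
  haveI : MeasurableSingletonClass ↥(cmBorelTriple L 3 v).M := ⟨fun x => isClosed_singleton.measurableSet⟩
  haveI : MeasurableSingletonClass ((↥(unitaryGroupOfForm (conjLocal L (IsCMField.complexConj L) v) (cmLocalForm L 3 v)) ⧸ (cmBorelTriple L 3 v).M) × ↥(cmBorelTriple L 3 v).M) :=
    Prod.instMeasurableSingletonClass
  haveI : SecondCountableTopology (↥(unitaryGroupOfForm (conjLocal L (IsCMField.complexConj L) v) (cmLocalForm L 3 v)) ⧸ (cmBorelTriple L 3 v).M) := (QuotientGroup.isQuotientMap_mk _).secondCountableTopology QuotientGroup.isOpenMap_coe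
  haveI : LocallyCompactSpace (↥(unitaryGroupOfForm (conjLocal L (IsCMField.complexConj L) v) (cmLocalForm L 3 v)) ⧸ (cmBorelTriple L 3 v).M) := QuotientGroup.instLocallyCompactSpace _
  haveI : SigmaCompactSpace (↥(unitaryGroupOfForm (conjLocal L (IsCMField.complexConj L) v) (cmLocalForm L 3 v)) ⧸ (cmBorelTriple L 3 v).M) := sigmaCompactSpace_of_locallyCompact_secondCountable
  haveI : SigmaFinite (quotientMeasure (cmBorelTriple L 3 v).M tm (isClosed_cmBorelTriple_M L v) ν) := SigmaFinite.of_isFiniteMeasureOnCompacts _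
  have hSo : IsOpen {t : ↥(cmBorelTriple L 3 v).M | IsRegularElt (((t : ↥(unitaryGroupOfForm (conjLocal L (IsCMField.complexConj L) v) (cmLocalForm L 3 v)))) : GL (Fin 3) (LocalRing L v))} :=
    isOpen_setOf_isRegularElt_torusU (conjLocal L (IsCMField.complexConj L) v) (cmLocalForm L 3 v) hR
  have hSm := hSo.measurableSet
  have hRTΩ : ∀ t : ↥(cmBorelTriple L 3 v).M, (t : ↥(unitaryGroupOfForm (conjLocal L (IsCMField.complexConj L) v) (cmLocalForm L 3 v))) ∈ {x | ∃ g t : ↥(unitaryGroupOfForm (conjLocal L (IsCMField.complexConj L) v) (cmLocalForm L 3 v)), t ∈ (cmBorelTriple L 3 v).M ∧ IsRegularElt (t : GL (Fin 3) (LocalRing L v)) ∧ g * t * g⁻¹ = x} → Subgroup.centralizer ({(t : ↥(unitaryGroupOfForm (conjLocal L (IsCMField.complexConj L) v) (cmLocalForm L 3 v)))} : Set ↥(unitaryGroupOfForm (conjLocal L (IsCMField.complexConj L) v) (cmLocalForm L 3 v))) = (cmBorelTriple L 3 v).M := fun t ht =>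
    centralizer_eq_cmTorus_of_isRegularElt L v t.2
      (isRegularElt_of_mem_hypSet (conjLocal L (IsCMField.complexConj L) v) (cmLocalForm L 3 v) ht)
  have hRcΩ : ∀ g x : ↥(unitaryGroupOfForm (conjLocal L (IsCMField.complexConj L) v) (cmLocalForm L 3 v)), x ∈ {x | ∃ g t : ↥(unitaryGroupOfForm (conjLocal L (IsCMField.complexConj L) v) (cmLocalForm L 3 v)), t ∈ (cmBorelTriple L 3 v).M ∧ IsRegularElt (t : GL (Fin 3) (LocalRing L v)) ∧ g * t * g⁻¹ = x} → g * x * g⁻¹ ∈ {x | ∃ g t : ↥(unitaryGroupOfForm (conjLocal L (IsCMField.complexConj L) v) (cmLocalForm L 3 v)), t ∈ (cmBorelTriple L 3 v).M ∧ IsRegularElt (t : GL (Fin 3) (LocalRing L v)) ∧ g * t * g⁻¹ = x} :=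
    fun g x hx => conj_mem_hypSet (conjLocal L (IsCMField.complexConj L) v) (cmLocalForm L 3 v) hx g
  have hDΩ : {p : (↥(unitaryGroupOfForm (conjLocal L (IsCMField.complexConj L) v) (cmLocalForm L 3 v)) ⧸ (cmBorelTriple L 3 v).M) × ↥(cmBorelTriple L 3 v).M | ((p.2 : ↥(cmBorelTriple L 3 v).M) : ↥(unitaryGroupOfForm (conjLocal L (IsCMField.complexConj L) v) (cmLocalForm L 3 v))) ∈ {x | ∃ g t : ↥(unitaryGroupOfForm (conjLocal L (IsCMField.complexConj L) v) (cmLocalForm L 3 v)), t ∈ (cmBorelTriple L 3 v).M ∧ IsRegularElt (t : GL (Fin 3) (LocalRing L v)) ∧ g * t * g⁻¹ = x}} = {p | IsRegularElt (((p.2 : ↥(unitaryGroupOfForm (conjLocal L (IsCMField.complexConj L) v) (cmLocalForm L 3 v)))) : GL (Fin 3) (LocalRing L v))} := by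
    ext p
    exact ⟨fun h => isRegularElt_of_mem_hypSet (conjLocal L (IsCMField.complexConj L) v) (cmLocalForm L 3 v) h,
      fun h => mem_hypSet_of_mem_torusU (conjLocal L (IsCMField.complexConj L) v) (cmLocalForm L 3 v) p.2.2 h⟩
  have hDm : MeasurableSet {p : (↥(unitaryGroupOfForm (conjLocal L (IsCMField.complexConj L) v) (cmLocalForm L 3 v)) ⧸ (cmBorelTriple L 3 v).M) × ↥(cmBorelTriple L 3 v).M | ((p.2 : ↥(cmBorelTriple L 3 v).M) : ↥(unitaryGroupOfForm (conjLocal L (IsCMField.complexConj L) v) (cmLocalForm L 3 v))) ∈ {x | ∃ g t : ↥(unitaryGroupOfForm (conjLocal L (IsCMField.complexConj L) v) (cmLocalForm L 3 v)), t ∈ (cmBorelTriple L 3 v).M ∧ IsRegularElt (t : GL (Fin 3) (LocalRing L v)) ∧ g * t * g⁻¹ = x}} := by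
    rw [hDΩ]; exact hSm.preimage measurable_snd
  have hinj := locallyInjOn_conjFamily (cmBorelTriple L 3 v).M hT hTc Φ hΦ {x | ∃ g t : ↥(unitaryGroupOfForm (conjLocal L (IsCMField.complexConj L) v) (cmLocalForm L 3 v)), t ∈ (cmBorelTriple L 3 v).M ∧ IsRegularElt (t : GL (Fin 3) (LocalRing L v)) ∧ g * t * g⁻¹ = x} hRTΩ hW0
  have hΩeq : Φ '' {p : (↥(unitaryGroupOfForm (conjLocal L (IsCMField.complexConj L) v) (cmLocalForm L 3 v)) ⧸ (cmBorelTriple L 3 v).M) × ↥(cmBorelTriple L 3 v).M | ((p.2 : ↥(cmBorelTriple L 3 v).M) : ↥(unitaryGroupOfForm (conjLocal L (IsCMField.complexConj L) v) (cmLocalForm L 3 v))) ∈ {x | ∃ g t : ↥(unitaryGroupOfForm (conjLocal L (IsCMField.complexConj L) v) (cmLocalForm L 3 v)), t ∈ (cmBorelTriple L 3 v).M ∧ IsRegularElt (t : GL (Fin 3) (LocalRing L v)) ∧ g * t * g⁻¹ = x}} = {x | ∃ g t : ↥(unitaryGroupOfForm (conjLocal L (IsCMField.complexConj L) v) (cmLocalForm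 L 3 v)), t ∈ (cmBorelTriple L 3 v).M ∧ IsRegularElt (t : GL (Fin 3) (LocalRing L v)) ∧ g * t * g⁻¹ = x} := by
    ext x
    constructor
    · rintro ⟨⟨q, t⟩, ht, rfl⟩
      obtain ⟨g, rfl⟩ := QuotientGroup.mk_surjective q
      rw [hΦ]
      exact hRcΩ g _ ht
    · rintro ⟨g, t, htT, ht, rfl⟩
      exact ⟨(QuotientGroup.mk g, ⟨t, htT⟩),
        mem_hypSet_of_mem_torusU (conjLocal L (IsCMField.complexConj L) v) (cmLocalForm L 3 v) htT ht, hΦ g ⟨t, htT⟩⟩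
  have hΩm : MeasurableSet {x | ∃ g t : ↥(unitaryGroupOfForm (conjLocal L (IsCMField.complexConj L) v) (cmLocalForm L 3 v)), t ∈ (cmBorelTriple L 3 v).M ∧ IsRegularElt (t : GL (Fin 3) (LocalRing L v)) ∧ g * t * g⁻¹ = x} := by
    rw [← hΩeq, ← Set.univ_inter {p : (↥(unitaryGroupOfForm (conjLocal L (IsCMField.complexConj L) v) (cmLocalForm L 3 v)) ⧸ (cmBorelTriple L 3 v).M) × ↥(cmBorelTriple L 3 v).M | ((p.2 : ↥(cmBorelTriple L 3 v).M) : ↥(unitaryGroupOfForm (conjLocal L (IsCMField.complexConj L) v) (cmLocalForm L 3 v))) ∈ {x | ∃ g t : ↥(unitaryGroupOfForm (conjLocal L (IsCMField.complexConj L) v) (cmLocalForm L 3 v)), t ∈ (cmBorelTriple L 3 v).M ∧ IsRegularElt (t : GL (Fin 3) (LocalRing L v)) ∧ g * t * g⁻¹ = x}}]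
    exact measurableSet_image_inter_of_locallyInjOn hDm hΦc hinj MeasurableSet.univ
  -- §c the fibre-count pull-back `μ` of `ν` and its Weil factorisation `μ = μ₀ ⊗ σ`; the radial formula for this `σ`
  obtain ⟨μ, hμ⟩ := exists_measure_apply_eq_lintegral_count_fibre hDm hΦc hinj ν
  have hw2 : ∀ y ∈ Φ '' {p : (↥(unitaryGroupOfForm (conjLocal L (IsCMField.complexConj L) v) (cmLocalForm L 3 v)) ⧸ (cmBorelTriple L 3 v).M) × ↥(cmBorelTriple L 3 v).M | ((p.2 : ↥(cmBorelTriple L 3 v).M) : ↥(unitaryGroupOfForm (conjLocal L (IsCMField.complexConj L) v) (cmLocalForm L 3 v))) ∈ {x | ∃ g t : ↥(unitaryGroupOfForm (conjLocal L (IsCMField.complexConj L) v) (cmLocalForm L 3 v)), t ∈ (cmBorelTriple L 3 v).M ∧ IsRegularElt (t : GL (Fin 3) (LocalRing L v)) ∧ g * t * g⁻¹ = x}}, Measure.count (Φ ⁻¹' {y} ∩ {p : (↥(unitaryGroupOfForm (conjLocal L (IsCMField.complexConj L) v) (cmLocalForm L 3 v)) ⧸ (cmBorelTriple L 3 v).M)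 × ↥(cmBorelTriple L 3 v).M | ((p.2 : ↥(cmBorelTriple L 3 v).M) : ↥(unitaryGroupOfForm (conjLocal L (IsCMField.complexConj L) v) (cmLocalForm L 3 v))) ∈ {x | ∃ g t : ↥(unitaryGroupOfForm (conjLocal L (IsCMField.complexConj L) v) (cmLocalForm L 3 v)), t ∈ (cmBorelTriple L 3 v).M ∧ IsRegularElt (t : GL (Fin 3) (LocalRing L v)) ∧ g * t * g⁻¹ = x}}) =
      ((((cmBorelTriple L 3 v).M).subgroupOf (Subgroup.normalizer (((cmBorelTriple L 3 v).M : Subgroup ↥(unitaryGroupOfForm (conjLocal L (IsCMField.complexConj L) v) (cmLocalForm L 3 v))) : Set ↥(unitaryGroupOfForm (conjLocal L (IsCMField.complexConj L) v) (cmLocalForm L 3 v))))).index : ℝ≥0∞) :=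
    fun y hy => count_fibre_conjFamily_eq (cmBorelTriple L 3 v).M hTc Φ hΦ {x | ∃ g t : ↥(unitaryGroupOfForm (conjLocal L (IsCMField.complexConj L) v) (cmLocalForm L 3 v)), t ∈ (cmBorelTriple L 3 v).M ∧ IsRegularElt (t : GL (Fin 3) (LocalRing L v)) ∧ g * t * g⁻¹ = x} hRTΩ hRcΩ hW0 hy
  obtain ⟨σ, hσfin, hσsf, hσcar, hprod⟩ :=
    exists_radial_prod_eq_fibreCount_conjFamily (cmBorelTriple L 3 v).M hT hTc ν Φ hΦ {x | ∃ g t : ↥(unitaryGroupOfForm (conjLocal L (IsCMField.complexConj L) v) (cmLocalForm L 3 v)), t ∈ (cmBorelTriple L 3 v).M ∧ IsRegularElt (t : GL (Fin 3) (LocalRing L v)) ∧ g * t * g⁻¹ = x} hΩm hRTΩ hRcΩ hW0 tm hμ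
  haveI := hσsf
  have hformula : ∀ f : ↥(unitaryGroupOfForm (conjLocal L (IsCMField.complexConj L) v) (cmLocalForm L 3 v)) → ℝ≥0∞, Measurable f →
      2 * ∫⁻ y in {x | ∃ g t : ↥(unitaryGroupOfForm (conjLocal L (IsCMField.complexConj L) v) (cmLocalForm L 3 v)), t ∈ (cmBorelTriple L 3 v).M ∧ IsRegularElt (t : GL (Fin 3) (LocalRing L v)) ∧ g * t * g⁻¹ = x}, f y ∂ν = ∫⁻ t, ∫⁻ q, f (Φ (q, t)) ∂(quotientMeasure (cmBorelTriple L 3 v).M tm (isClosed_cmBorelTriple_M L v) ν) ∂σ := by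
    intro f hf
    have h1 := lintegral_comp_eq_mul_setLIntegral_image hDm hΦc hinj hμ hw2 hf
    rw [hW, hΩeq, ← hprod, lintegral_prod_symm (fun z : (↥(unitaryGroupOfForm (conjLocal L (IsCMField.complexConj L) v) (cmLocalForm L 3 v)) ⧸ (cmBorelTriple L 3 v).M) × ↥(cmBorelTriple L 3 v).M => f (Φ z))
      (hf.comp hΦc.measurable).aemeasurable] at h1
    simpa only [Nat.cast_ofNat] using h1.symm
  -- §d the tube evaluation for ANY measurable `A` and any measurable `W`-free regular `V`
  refine ⟨σ, hσfin, hσsf, ?_, hformula, fun A hAm V hVm hVreg hVfree => ?_⟩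
  · convert hσcar using 2
    ext t
    simp only [mem_setOf_eq]
    exact not_congr ⟨fun h => mem_hypSet_of_mem_torusU (conjLocal L (IsCMField.complexConj L) v) (cmLocalForm L 3 v) t.2 h,
      fun h => isRegularElt_of_mem_hypSet (conjLocal L (IsCMField.complexConj L) v) (cmLocalForm L 3 v) h⟩
  have hE : MeasurableSet (A ×ˢ V) := hAm.prod hVm
  have hEsub : A ×ˢ V ⊆ {p : (↥(unitaryGroupOfForm (conjLocal L (IsCMField.complexConj L) v) (cmLocalForm L 3 v)) ⧸ (cmBorelTriple L 3 v).M) × ↥(cmBorelTriple L 3 v).M | ((p.2 : ↥(cmBorelTriple L 3 v).M) : ↥(unitaryGroupOfForm (conjLocal L (IsCMField.complexConj L) v) (cmLocalForm L 3 v))) ∈ {x | ∃ g t : ↥(unitaryGroupOfForm (conjLocal L (IsCMField.complexConj L) v) (cmLocalForm L 3 v)), t ∈ (cmBorelTriple L 3 v).M ∧ IsRegularElt (t : GL (Fin 3) (LocalRing L v)) ∧ g * t * g⁻¹ = x}} := fun p hp =>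
    mem_hypSet_of_mem_torusU (conjLocal L (IsCMField.complexConj L) v) (cmLocalForm L 3 v) p.2.2 (hVreg p.2 hp.2)
  have hEim : MeasurableSet (Φ '' (A ×ˢ V)) := by
    rw [← inter_eq_left.2 hEsub]; exact measurableSet_image_inter_of_locallyInjOn hDm hΦc hinj hE
  -- every fibre meets `A × V` at most once
  have hsub : ∀ y, (Φ ⁻¹' {y} ∩ (A ×ˢ V ∩ {p : (↥(unitaryGroupOfForm (conjLocal L (IsCMField.complexConj L) v) (cmLocalForm L 3 v)) ⧸ (cmBorelTriple L 3 v).M) × ↥(cmBorelTriple L 3 v).M | ((p.2 : ↥(cmBorelTriple L 3 v).M) : ↥(unitaryGroupOfForm (conjLocal L (IsCMField.complexConj L) v) (cmLocalForm L 3 v))) ∈ {x | ∃ g t : ↥(unitaryGroupOfForm (conjLocal L (IsCMField.complexConj L) v) (cmLocalForm L 3 v)), t ∈ (cmBorelTriple L 3 v).M ∧ IsRegularElt (t : GL (Fin 3) (LocalRing L v)) ∧ g * t * g⁻¹ = x}})).Subsingleton := by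
    rintro y ⟨q, t⟩ ⟨hyq, ⟨⟨-, htV⟩, -⟩⟩ ⟨q', t'⟩ ⟨hyq', ⟨⟨-, ht'V⟩, -⟩⟩
    obtain ⟨g, rfl⟩ := QuotientGroup.mk_surjective q
    obtain ⟨g', rfl⟩ := QuotientGroup.mk_surjective q'
    simp only [mem_preimage, mem_singleton_iff, hΦ] at hyq hyq'
    rcases fibre_dichotomy (conjLocal L (IsCMField.complexConj L) v) hR hJ hw t'.2 (hVreg t' ht'V) t.2 (hVreg t htV)
        (hyq.trans hyq'.symm) with ⟨h1, h2⟩ | ⟨-, h2⟩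
    · refine Prod.ext ?_ (Subtype.ext h2)
      exact (QuotientGroup.eq.2 h1).symm
    · exact absurd h2 (hVfree t' ht'V t htV)
  have hcount : ∀ y, Measure.count (Φ ⁻¹' {y} ∩ (A ×ˢ V ∩ {p : (↥(unitaryGroupOfForm (conjLocal L (IsCMField.complexConj L) v) (cmLocalForm L 3 v)) ⧸ (cmBorelTriple L 3 v).M) × ↥(cmBorelTriple L 3 v).M | ((p.2 : ↥(cmBorelTriple L 3 v).M) : ↥(unitaryGroupOfForm (conjLocal L (IsCMField.complexConj L) v) (cmLocalForm L 3 v))) ∈ {x | ∃ g t : ↥(unitaryGroupOfForm (conjLocal L (IsCMField.complexConj L) v) (cmLocalForm L 3 v)), t ∈ (cmBorelTriple L 3 v).M ∧ IsRegularElt (t : GL (Fin 3) (LocalRing L v)) ∧ g * t * g⁻¹ = x}})) = (Φ '' (A ×ˢ V)).indicator 1 y := by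
    intro y
    by_cases hy : y ∈ Φ '' (A ×ˢ V)
    · obtain ⟨p, hp, rfl⟩ := hy
      have hmem : p ∈ Φ ⁻¹' {Φ p} ∩ (A ×ˢ V ∩ {p : (↥(unitaryGroupOfForm (conjLocal L (IsCMField.complexConj L) v) (cmLocalForm L 3 v)) ⧸ (cmBorelTriple L 3 v).M) × ↥(cmBorelTriple L 3 v).M | ((p.2 : ↥(cmBorelTriple L 3 v).M) : ↥(unitaryGroupOfForm (conjLocal L (IsCMField.complexConj L) v) (cmLocalForm L 3 v))) ∈ {x | ∃ g t : ↥(unitaryGroupOfForm (conjLocal L (IsCMField.complexConj L) v) (cmLocalForm L 3 v)), t ∈ (cmBorelTriple L 3 v).M ∧ IsRegularElt (t : GL (Fin 3) (LocalRing L v)) ∧ g * t * g⁻¹ = x}}) := ⟨rfl, hp, hEsub hp⟩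
      rw [(hsub (Φ p)).eq_singleton_of_mem hmem, Measure.count_singleton, indicator_of_mem (mem_image_of_mem Φ hp),
        Pi.one_apply]
    · have hempty : Φ ⁻¹' {y} ∩ (A ×ˢ V ∩ {p : (↥(unitaryGroupOfForm (conjLocal L (IsCMField.complexConj L) v) (cmLocalForm L 3 v)) ⧸ (cmBorelTriple L 3 v).M) × ↥(cmBorelTriple L 3 v).M | ((p.2 : ↥(cmBorelTriple L 3 v).M) : ↥(unitaryGroupOfForm (conjLocal L (IsCMField.complexConj L) v) (cmLocalForm L 3 v))) ∈ {x | ∃ g t : ↥(unitaryGroupOfForm (conjLocal L (IsCMField.complexConj L) v) (cmLocalForm L 3 v)), t ∈ (cmBorelTriple L 3 v).M ∧ IsRegularElt (t : GL (Fin 3) (LocalRing L v)) ∧ g * t * g⁻¹ = x}}) = ∅ :=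
        eq_empty_of_forall_notMem fun p hp => hy ⟨p, hp.2.1, hp.1⟩
      rw [hempty, measure_empty, indicator_of_notMem hy]
  have hμE : μ (A ×ˢ V) = ν (Φ '' (A ×ˢ V)) := by
    rw [hμ _ hE, lintegral_congr fun y => hcount y, lintegral_indicator_one hEim]
  have hμE' : μ (A ×ˢ V) = (quotientMeasure (cmBorelTriple L 3 v).M tm (isClosed_cmBorelTriple_M L v) ν) A * σ V := by
    rw [← hprod, Measure.prod_prod]
  rw [← hμE, hμE']

/-! ## §2 A `W`-free regular open neighbourhood of a regular point (★ p849811 §e, exported) -/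

/-- **Every regular `t₀ ∈ T` has an open neighbourhood of REGULAR elements on which `t′ ≠ w t w⁻¹`** (★ p849811 §e: `w t₀ w⁻¹ ≠ t₀` because `w ∉ T = Z(t₀)`
(★ `weyl_not_mem_torusU`, ★ `centralizer_eq_cmTorus_of_isRegularElt`), Hausdorff separation, and `T^{reg}` is open ★ `isOpen_setOf_isRegularElt_torusU`) — exported for (J6), which picks
its level coset `t₀ T_γ` inside this neighbourhood. [cite: Rogawski1990, §12.5 p. 182] [cite: HarishChandra1970, Lemma 22] -/
theorem exists_isOpen_regular_wfree_nhds
    (hns : ∀ w : PlacesOver L v, IsCMField.complexConj L • w.1 = w.1)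
    [T2Space ↥(unitaryGroupOfForm (conjLocal L (IsCMField.complexConj L) v) (cmLocalForm L 3 v))]
    (w : ↥(unitaryGroupOfForm (conjLocal L (IsCMField.complexConj L) v) (cmLocalForm L 3 v))) (hw : Units.val (w : GL (Fin 3) (LocalRing L v)) = cmLocalForm L 3 v)
    (t₀ : ↥(cmBorelTriple L 3 v).M) (ht₀ : IsRegularElt (((t₀ : ↥(unitaryGroupOfForm (conjLocal L (IsCMField.complexConj L) v) (cmLocalForm L 3 v)))) : GL (Fin 3) (LocalRing L v))) :
    ∃ U₁ : Set ↥(cmBorelTriple L 3 v).M, IsOpen U₁ ∧ t₀ ∈ U₁ ∧ (∀ t ∈ U₁, IsRegularElt (((t : ↥(unitaryGroupOfForm (conjLocal L (IsCMField.complexConj L) v) (cmLocalForm L 3 v)))) : GL (Fin 3) (LocalRing L v))) ∧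
      ∀ t ∈ U₁, ∀ t' ∈ U₁, ((t' : ↥(cmBorelTriple L 3 v).M) : ↥(unitaryGroupOfForm (conjLocal L (IsCMField.complexConj L) v) (cmLocalForm L 3 v))) ≠ w * t * w⁻¹ := by
  haveI : Nontrivial (LocalRing L v) := UnitaryGroup.nontrivial_localRing L v
  have hR : ∀ x : LocalRing L v, x ≠ 0 → IsUnit x := isUnit_of_ne_zero_of_nonsplit L v hns
  have hJ : cmLocalForm L 3 v = (StdForm.antidiagonal 3).over (LocalRing L v) := cmLocalForm_eq_over L 3 v
  have hSo : IsOpen {t : ↥(cmBorelTriple L 3 v).M | IsRegularElt (((t : ↥(unitaryGroupOfForm (conjLocal L (IsCMField.complexConj L) v) (cmLocalForm L 3 v)))) : GL (Fin 3) (LocalRing L v))} :=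
    isOpen_setOf_isRegularElt_torusU (conjLocal L (IsCMField.complexConj L) v) (cmLocalForm L 3 v) hR
  have hne : (t₀ : ↥(unitaryGroupOfForm (conjLocal L (IsCMField.complexConj L) v) (cmLocalForm L 3 v))) ≠ w * t₀ * w⁻¹ := by
    intro h
    apply weyl_not_mem_torusU (conjLocal L (IsCMField.complexConj L) v) hJ hw
    have hwZ : w ∈ Subgroup.centralizer ({(t₀ : ↥(unitaryGroupOfForm (conjLocal L (IsCMField.complexConj L) v) (cmLocalForm L 3 v)))} : Set ↥(unitaryGroupOfForm (conjLocal L (IsCMField.complexConj L) v) (cmLocalForm L 3 v))) := by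
      rw [Subgroup.mem_centralizer_iff]
      intro g hg
      rw [mem_singleton_iff.1 hg]
      exact (mul_inv_eq_iff_eq_mul.1 h.symm).symm
    rw [centralizer_eq_cmTorus_of_isRegularElt L v t₀.2 ht₀] at hwZ
    exact hwZ
  obtain ⟨O₁, O₂, hO₁, hO₂, h₁, h₂, hdisj⟩ := t2_separation hne
  have hcont : Continuous fun t : ↥(cmBorelTriple L 3 v).M => w * (t : ↥(unitaryGroupOfForm (conjLocal L (IsCMField.complexConj L) v) (cmLocalForm L 3 v))) * w⁻¹ := (continuous_const.mul continuous_subtype_val).mul continuous_const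
  refine ⟨{t | (t : ↥(unitaryGroupOfForm (conjLocal L (IsCMField.complexConj L) v) (cmLocalForm L 3 v))) ∈ O₁ ∧ w * (t : ↥(unitaryGroupOfForm (conjLocal L (IsCMField.complexConj L) v) (cmLocalForm L 3 v))) * w⁻¹ ∈ O₂} ∩ {t : ↥(cmBorelTriple L 3 v).M | IsRegularElt (((t : ↥(unitaryGroupOfForm (conjLocal L (IsCMField.complexConj L) v) (cmLocalForm L 3 v)))) : GL (Fin 3) (LocalRing L v))},
    ((hO₁.preimage continuous_subtype_val).inter (hO₂.preimage hcont)).inter hSo, ⟨⟨h₁, h₂⟩, ht₀⟩, fun t ht => ht.2,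
    fun t ht t' ht' h => hdisj.ne_of_mem ht'.1.1 ht.1.2 h⟩


end CM

end Summit.HodgeConjecture.HodgeConjecture.Cruxes.H413.F0P3cStCharTSWeylHypTubeSigma

end
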